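import Mathlib.LinearAlgebra.Dual.Lemmas
import Mathlib.LinearAlgebra.LinearIndependent.Lemmas
import Mathlib.RingTheory.Noetherian.Basic
import HarnessLib

/-!
# The reflexive hull of a lattice inside a torsion-free module (stalk input of G2 (iv), chain W4.4)

`[OURS · L W4.4]` Crux `HomologicalConductor.NoZenoR` (stmt-ResolutionOfSingularities-19943; twin `NoZeno`
stmt-16483), line `sandwich-cluster`, S3 Layer 2 = THEOREM A, G-layer item **G2 (iv)**: the full sheaf
`M̃ = 𝒪_X · M ⊆ K(X)^r` of a reflexive module over a rational surface singularity is locally free (idea-1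
THEOREM Q-rat §3 (B1); owner res-D-pv-045 AS res-L0-w44-stub-8, route «`M̃^{∨∨}/M̃` finitely supported,
`Ȟ⁰ ↪ Ȟ¹(M̃) = 0`»).  Its STALK ALGEBRA is the **reflexive hull** of a finitely generated submodule `N`
(= `𝒪_{X,x} · M`) of a torsion-free module `W` (= `K(X)^r`), constructed here INSIDE `W`, coordinate-free:
* `reflexiveHull N` — the `w` with `s • w ∈ N` for some `s ≠ 0` such that every `φ ∈ N*` takes on `s • w`
  a value divisible by `s` («`φ_K(w) ∈ S`»; the choice of `s` is immaterial: `dvd_apply_of_mem_reflexiveHull`);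
  `le_reflexiveHull`, `exists_smul_mem_of_mem_reflexiveHull` (`N ≤ hull N ≤ K·N`);
* `reflexiveHullToDoubleDual` — the canonical map `hull N → N**`, `w ↦ (φ ↦ φ(s w)/s)`, extending
  `Module.Dual.eval` (`reflexiveHullToDoubleDual_inclusion`); `reflexiveHull_eq_self_of_isReflexive`;
* `exists_lattice` — a finitely generated `N` contains a finite free lattice `⊕ S xᵢ ⊇ d • N`, `d ≠ 0`;
* `reflexiveHullToDoubleDual_bijective`, `reflexiveHullEquiv : hull N ≃ₗ[S] N**`, `finite_reflexiveHull` —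
  for `N` finitely generated in a vector space over a field through which `S` acts.
Krull's height-one criterion for membership in the hull, agreement of `hull N` with `N` off the closed
point of a two-dimensional regular local ring, and freeness there: sibling `…ReflexiveHullLocalization.lean`.  Replaces the role of no printed item of the manuscript under
review (Hironaka 2017); textbook algebra; AI-written, weaker than expert review.
[cite: BrunsHerzog1998, Prop. 1.4.1]
-/


-- single-problem summit: the doubled namespace component `ResolutionOfSingularities` is forced
set_option linter.dupNamespace false

noncomputable section

open Module

universe u v

namespace Summit.ResolutionOfSingularities.ResolutionOfSingularities.Theorems.NoZeno.SandwichCluster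

section Def

variable {S : Type u} [CommRing S] [IsDomain S]
variable {W : Type v} [AddCommGroup W] [Module S W]

/-- The **reflexive hull** of a submodule `N` of a torsion-free `S`-module `W`, inside `W`: the vectors
`w` with `s • w ∈ N` for some `s ≠ 0` such that every linear functional `φ : N → S` takes on every
`n ∈ N` with `n = s • w` a value divisible by `s` — i.e. `w ∈ K·N` and `φ_K(w) ∈ S` for all `φ ∈ N*`.
For `N` finitely generated and `W` a vector space over the fraction field this is (the image in `W`
of) the double dual `N**` (`reflexiveHullEquiv`). [cite: BrunsHerzog1998, Prop. 1.4.1] -/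
def reflexiveHull (N : Submodule S W) : Submodule S W where
  carrier := {w | ∃ s : S, s ≠ 0 ∧ (∃ n : N, (n : W) = s • w) ∧
    ∀ (φ : Module.Dual S N) (n : N), (n : W) = s • w → s ∣ φ n}
  zero_mem' := ⟨1, one_ne_zero, ⟨0, by simp⟩, fun φ n hn => by
    have : n = 0 := by
      apply Subtype.ext
      simpa using hn
    simp [this]⟩
  add_mem' := by
    rintro w₁ w₂ ⟨s₁, hs₁, ⟨n₁, hn₁⟩, h₁⟩ ⟨s₂, hs₂, ⟨n₂, hn₂⟩, h₂⟩
    refine ⟨s₁ * s₂, mul_ne_zero hs₁ hs₂, ⟨s₂ • n₁ + s₁ • n₂, ?_⟩, fun φ n hn => ?_⟩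
    · simp only [Submodule.coe_add, Submodule.coe_smul_of_tower, hn₁, hn₂, smul_add, smul_smul,
        mul_comm s₂ s₁]
    · have hn' : n = s₂ • n₁ + s₁ • n₂ := by
        apply Subtype.ext
        simp only [hn, Submodule.coe_add, Submodule.coe_smul_of_tower, hn₁, hn₂, smul_add,
          smul_smul, mul_comm s₂ s₁]
      obtain ⟨t₁, ht₁⟩ := h₁ φ n₁ hn₁
      obtain ⟨t₂, ht₂⟩ := h₂ φ n₂ hn₂
      refine ⟨t₁ + t₂, ?_⟩
      rw [hn', map_add, map_smul, map_smul, smul_eq_mul, smul_eq_mul, ht₁, ht₂]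
      ring
  smul_mem' := by
    rintro a w ⟨s, hs, ⟨n₀, hn₀⟩, h⟩
    refine ⟨s, hs, ⟨a • n₀, by simp [hn₀, smul_comm a s w]⟩, fun φ n hn => ?_⟩
    have hn' : n = a • n₀ := by
      apply Subtype.ext
      simp [hn, hn₀, smul_comm a s w]
    obtain ⟨t, ht⟩ := h φ n₀ hn₀
    exact ⟨a * t, by rw [hn', map_smul, smul_eq_mul, ht]; ring⟩

variable (N : Submodule S W)

/-- Unfolding of membership in the reflexive hull. [cite: BrunsHerzog1998, Prop. 1.4.1] -/
theorem mem_reflexiveHull_iff {w : W} :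
    w ∈ reflexiveHull N ↔ ∃ s : S, s ≠ 0 ∧ (∃ n : N, (n : W) = s • w) ∧
      ∀ (φ : Module.Dual S N) (n : N), (n : W) = s • w → s ∣ φ n :=
  Iff.rfl

/-- The divisibility in the definition of the hull holds for EVERY scalar `s'` with `s' • w ∈ N`, not
only the witnessing one. [cite: BrunsHerzog1998, Prop. 1.4.1] -/
theorem dvd_apply_of_mem_reflexiveHull {w : W} (hw : w ∈ reflexiveHull N) {s' : S} {n : N}
    (hn : (n : W) = s' • w) (φ : Module.Dual S N) : s' ∣ φ n := by
  obtain ⟨s, hs, ⟨n₀, hn₀⟩, h⟩ := hw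
  obtain ⟨t, ht⟩ := h φ n₀ hn₀
  refine ⟨t, mul_left_cancel₀ hs ?_⟩
  have hsn : s • n = s' • n₀ := by
    apply Subtype.ext
    simp only [Submodule.coe_smul_of_tower, hn, hn₀, smul_smul, mul_comm s s']
  calc s * φ n = φ (s • n) := by rw [map_smul, smul_eq_mul]
    _ = s' * φ n₀ := by rw [hsn, map_smul, smul_eq_mul]
    _ = s * (s' * t) := by rw [ht]; ring

/-- Membership criterion with a prescribed scalar: if `s ≠ 0` and `n = s • w ∈ N`, then `w` is in the
hull iff `s ∣ φ n` for every functional `φ`. [cite: BrunsHerzog1998, Prop. 1.4.1] -/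
theorem mem_reflexiveHull_iff_forall_dvd {w : W} {s : S} (hs : s ≠ 0) (n : N) (hn : (n : W) = s • w) :
    w ∈ reflexiveHull N ↔ ∀ φ : Module.Dual S N, s ∣ φ n := by
  refine ⟨fun hw φ => dvd_apply_of_mem_reflexiveHull N hw hn φ, fun h => ⟨s, hs, ⟨n, hn⟩, ?_⟩⟩
  intro φ n' hn'
  have : n' = n := Subtype.ext (hn'.trans hn.symm)
  rw [this]
  exact h φ

/-- `N` lies in its reflexive hull. [cite: BrunsHerzog1998, Prop. 1.4.1] -/
theorem le_reflexiveHull : N ≤ reflexiveHull N := fun w hw =>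
  (mem_reflexiveHull_iff_forall_dvd N one_ne_zero ⟨w, hw⟩ (by simp)).2 fun φ => one_dvd _

/-- Every vector of the hull has a non-zero multiple in `N` (`hull N ⊆ K·N`).
[cite: BrunsHerzog1998, Prop. 1.4.1] -/
theorem exists_smul_mem_of_mem_reflexiveHull {w : W} (hw : w ∈ reflexiveHull N) :
    ∃ s : S, s ≠ 0 ∧ s • w ∈ N := by
  obtain ⟨s, hs, ⟨n, hn⟩, -⟩ := hw
  exact ⟨s, hs, hn ▸ n.2⟩

/-! ### The pairing `hull N × N* → S` and the map to the double dual -/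

/-- The value `φ(s • w)/s ∈ S` of a functional `φ ∈ N*` on a vector `w` of the hull (well defined by
`dvd_apply_of_mem_reflexiveHull`; defined by choice, characterised by `hullPairing_spec`).
[cite: BrunsHerzog1998, Prop. 1.4.1] -/
def hullPairing (w : reflexiveHull N) (φ : Module.Dual S N) : S :=
  (dvd_apply_of_mem_reflexiveHull N w.2 (Classical.choose_spec (Classical.choose_spec w.2).2.1)
    φ).choose

/-- Characterisation of `hullPairing`: for ANY scalar `s` and `n ∈ N` with `n = s • w`,
`φ n = s * hullPairing w φ`. [cite: BrunsHerzog1998, Prop. 1.4.1] -/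
theorem hullPairing_spec (w : reflexiveHull N) (φ : Module.Dual S N) {s : S} {n : N}
    (hn : (n : W) = s • (w : W)) : φ n = s * hullPairing N w φ := by
  -- the witnessing data of `w.2`
  set s₀ := Classical.choose w.2 with hs₀def
  have hs₀ : s₀ ≠ 0 := (Classical.choose_spec w.2).1
  set n₀ := Classical.choose (Classical.choose_spec w.2).2.1 with hn₀def
  have hn₀ : (n₀ : W) = s₀ • (w : W) := Classical.choose_spec (Classical.choose_spec w.2).2.1
  have ht : φ n₀ = s₀ * hullPairing N w φ :=
    (dvd_apply_of_mem_reflexiveHull N w.2 hn₀ φ).choose_spec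
  -- compare through `s₀ • n = s • n₀`
  have hsn : s₀ • n = s • n₀ := by
    apply Subtype.ext
    simp only [Submodule.coe_smul_of_tower, hn, hn₀, smul_smul, mul_comm s₀ s]
  apply mul_left_cancel₀ hs₀
  calc s₀ * φ n = φ (s₀ • n) := by rw [map_smul, smul_eq_mul]
    _ = s * φ n₀ := by rw [hsn, map_smul, smul_eq_mul]
    _ = s₀ * (s * hullPairing N w φ) := by rw [ht]; ring

/-- The canonical map from the reflexive hull to the double dual, `w ↦ (φ ↦ φ(s • w)/s)`.
[cite: BrunsHerzog1998, Prop. 1.4.1] -/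
def reflexiveHullToDoubleDual : reflexiveHull N →ₗ[S] Module.Dual S (Module.Dual S N) where
  toFun w :=
    { toFun := hullPairing N w
      map_add' := fun φ φ' => by
        obtain ⟨s, hs, ⟨n, hn⟩, -⟩ := w.2
        apply mul_left_cancel₀ hs
        rw [← hullPairing_spec N w (φ + φ') hn, LinearMap.add_apply, mul_add,
          ← hullPairing_spec N w φ hn, ← hullPairing_spec N w φ' hn]
      map_smul' := fun a φ => by
        obtain ⟨s, hs, ⟨n, hn⟩, -⟩ := w.2
        apply mul_left_cancel₀ hs
        rw [← hullPairing_spec N w (a • φ) hn, LinearMap.smul_apply, smul_eq_mul,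
          RingHom.id_apply, smul_eq_mul, mul_left_comm, ← hullPairing_spec N w φ hn] }
  map_add' w₁ w₂ := by
    ext φ
    obtain ⟨s₁, hs₁, ⟨n₁, hn₁⟩, -⟩ := w₁.2
    obtain ⟨s₂, hs₂, ⟨n₂, hn₂⟩, -⟩ := w₂.2
    have hs : s₁ * s₂ ≠ 0 := mul_ne_zero hs₁ hs₂
    have hn : ((s₂ • n₁ + s₁ • n₂ : N) : W) = (s₁ * s₂) • ((w₁ + w₂ : reflexiveHull N) : W) := by
      simp only [Submodule.coe_add, Submodule.coe_smul_of_tower, hn₁, hn₂, smul_add, smul_smul,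
        mul_comm s₂ s₁]
    have h1 : ((s₂ • n₁ : N) : W) = (s₁ * s₂) • (w₁ : W) := by
      simp only [Submodule.coe_smul_of_tower, hn₁, smul_smul, mul_comm s₂ s₁]
    have h2 : ((s₁ • n₂ : N) : W) = (s₁ * s₂) • (w₂ : W) := by
      simp only [Submodule.coe_smul_of_tower, hn₂, smul_smul]
    change hullPairing N (w₁ + w₂) φ = hullPairing N w₁ φ + hullPairing N w₂ φ
    apply mul_left_cancel₀ hs
    rw [← hullPairing_spec N (w₁ + w₂) φ hn, map_add, mul_add,
      ← hullPairing_spec N w₁ φ h1, ← hullPairing_spec N w₂ φ h2]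
  map_smul' a w := by
    ext φ
    obtain ⟨s, hs, ⟨n, hn⟩, -⟩ := w.2
    have hn' : ((a • n : N) : W) = s • ((a • w : reflexiveHull N) : W) := by
      simp only [Submodule.coe_smul_of_tower, hn, smul_comm a s]
    change hullPairing N (a • w) φ = a • hullPairing N w φ
    apply mul_left_cancel₀ hs
    rw [← hullPairing_spec N (a • w) φ hn', map_smul, smul_eq_mul, smul_eq_mul, mul_left_comm,
      ← hullPairing_spec N w φ hn]

/-- Defining property of `reflexiveHullToDoubleDual`: `φ n = s * (toDoubleDual w) φ` whenever
`n = s • w`. [cite: BrunsHerzog1998, Prop. 1.4.1] -/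
theorem reflexiveHullToDoubleDual_spec (w : reflexiveHull N) (φ : Module.Dual S N) {s : S}
    {n : N} (hn : (n : W) = s • (w : W)) :
    φ n = s * reflexiveHullToDoubleDual N w φ :=
  hullPairing_spec N w φ hn

/-- On `N` itself the map to the double dual is the evaluation map `Module.Dual.eval`.
[cite: BrunsHerzog1998, Prop. 1.4.1] -/
theorem reflexiveHullToDoubleDual_inclusion (n : N) :
    reflexiveHullToDoubleDual N ⟨n, le_reflexiveHull N n.2⟩ = Module.Dual.eval S N n := by
  ext φ
  have h := reflexiveHullToDoubleDual_spec N ⟨n, le_reflexiveHull N n.2⟩ φ (s := 1)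
    (n := n) (by rw [one_smul])
  rw [one_mul] at h
  rw [Module.Dual.eval_apply, ← h]

/-- The map to the double dual intertwines the inclusion `N ≤ hull N` with `Dual.eval`.
[cite: BrunsHerzog1998, Prop. 1.4.1] -/
theorem reflexiveHullToDoubleDual_comp_inclusion :
    reflexiveHullToDoubleDual N ∘ₗ Submodule.inclusion (le_reflexiveHull N) = Module.Dual.eval S N := by
  ext n φ
  change reflexiveHullToDoubleDual N ⟨n, le_reflexiveHull N n.2⟩ φ = Module.Dual.eval S N n φ
  rw [reflexiveHullToDoubleDual_inclusion]

/-- **A reflexive module is its own hull.** [cite: BrunsHerzog1998, Prop. 1.4.1] -/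
theorem reflexiveHull_eq_self_of_isReflexive [NoZeroSMulDivisors S W] [Module.IsReflexive S N] :
    reflexiveHull N = N := by
  refine le_antisymm (fun w hw => ?_) (le_reflexiveHull N)
  obtain ⟨s, hs, ⟨n, hn⟩, -⟩ := id hw
  let ψ := reflexiveHullToDoubleDual N ⟨w, hw⟩
  let m₀ : N := (Module.evalEquiv S N).symm ψ
  have hm₀ : ∀ φ : Module.Dual S N, φ m₀ = ψ φ := fun φ =>
    Module.apply_evalEquiv_symm_apply (R := S) (M := N) φ ψ
  -- every functional agrees on `n = s • w` and `s • m₀`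
  have hzero : n - s • m₀ = 0 := by
    apply (Module.bijective_dual_eval S N).1
    rw [map_zero]
    ext φ
    rw [Module.Dual.eval_apply, LinearMap.zero_apply, map_sub, map_smul, hm₀ φ, smul_eq_mul,
      reflexiveHullToDoubleDual_spec N ⟨w, hw⟩ φ hn, sub_self]
  have hV : s • w = s • (m₀ : W) := by
    have := congrArg (fun m : N => (m : W)) hzero
    simpa [sub_eq_zero, hn] using this
  rw [smul_right_injective W hs hV]
  exact m₀.2

end Def

/-! ### Lattices and the identification `hull N ≅ N**` -/

section Lattice

variable {S : Type u} [CommRing S] [IsDomain S]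
variable {W : Type v} [AddCommGroup W] [Module S W]

/-- A finitely generated submodule `N` of a torsion-free module contains a FREE LATTICE: a finite
linearly independent family `x` in `N` and a scalar `d ≠ 0` with `d • N ⊆ ⊕ S xᵢ` (a maximal linearly
independent subfamily of a finite generating set). [cite: BrunsHerzog1998, Prop. 1.4.1 (folklore)] -/
theorem exists_lattice (N : Submodule S W) [Module.Finite S N] :
    ∃ (ι : Type) (_ : Fintype ι) (x : ι → N), LinearIndependent S x ∧
      ∃ d : S, d ≠ 0 ∧ ∀ n : N, d • n ∈ Submodule.span S (Set.range x) := by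
  classical
  obtain ⟨m, g, hg⟩ := Module.Finite.exists_fin (R := S) (M := N)
  obtain ⟨t, hli, hmax⟩ := exists_maximal_linearIndepOn S g
  -- for every generator a non-zero scalar taking it into the span of the independent ones
  have hgen : ∀ i : Fin m, ∃ a : S, a ≠ 0 ∧ a • g i ∈ Submodule.span S (g '' t) := by
    intro i
    by_cases hi : i ∈ t
    · exact ⟨1, one_ne_zero, by rw [one_smul]; exact Submodule.subset_span ⟨i, hi, rfl⟩⟩
    · exact hmax i hi
  choose a ha hmem using hgen
  refine ⟨↥t, inferInstance, fun i => g i, hli, ∏ i, a i, Finset.prod_ne_zero_iff.mpr fun i _ => ha i,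
    fun n => ?_⟩
  have hrange : Set.range (fun i : ↥t => g i) = g '' t := by
    ext y; simp
  rw [hrange]
  -- `n` is a linear combination of the generators
  obtain ⟨c, rfl⟩ : ∃ c : Fin m →₀ S, Finsupp.linearCombination S g c = n := by
    have : n ∈ Submodule.span S (Set.range g) := by rw [hg]; trivial
    exact (Finsupp.mem_span_range_iff_exists_finsupp.mp this)
  rw [Finsupp.linearCombination_apply, Finsupp.smul_sum]
  refine Submodule.sum_mem _ fun i _ => ?_
  dsimp only
  rw [smul_smul, mul_comm, mul_smul]
  refine Submodule.smul_mem _ _ ?_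
  obtain ⟨b, hb⟩ : a i ∣ ∏ j, a j := Finset.dvd_prod_of_mem a (Finset.mem_univ i)
  rw [hb, mul_comm, mul_smul]
  exact Submodule.smul_mem _ _ (hmem i)

variable {K : Type*} [Field K] [Algebra S K] [Module K W] [IsScalarTower S K W]

/-- **The hull is the double dual.**  For `N` finitely generated inside a vector space `W` over a field
`K ⊇ S` through which `S` acts (so `W` is divisible by the non-zero scalars of `S`), the canonical map
`hull N → N**` is bijective: injective because the coordinate functionals of a lattice separate the
points of `N`, surjective because `ψ ∈ N**` is hit by `w = d⁻¹ Σ ψ(cᵢ) xᵢ`, `cᵢ` the lattice coordinates.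
[cite: BrunsHerzog1998, Prop. 1.4.1] -/
theorem reflexiveHullToDoubleDual_bijective [NoZeroSMulDivisors S W] [FaithfulSMul S K]
    (N : Submodule S W) [Module.Finite S N] :
    Function.Bijective (reflexiveHullToDoubleDual N) := by
  classical
  have hinjK : Function.Injective (algebraMap S K) := FaithfulSMul.algebraMap_injective S K
  obtain ⟨ι, _, x, hli, d, hd, hdN⟩ := exists_lattice N
  -- lattice coordinates `c i : N →ₗ S`, with `d • n = Σ c i n • x i`
  let ρ : N →ₗ[S] Submodule.span S (Set.range x) :=
    LinearMap.codRestrict _ (d • LinearMap.id) fun n => hdN n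
  let c : ι → Module.Dual S N := fun i => (Finsupp.lapply i) ∘ₗ hli.repr ∘ₗ ρ
  have hc : ∀ n : N, d • n = ∑ i, c i n • x i := by
    intro n
    have h1 := hli.linearCombination_repr (ρ n)
    rw [Finsupp.linearCombination_apply, Finsupp.sum_fintype _ _ (fun i => by simp)] at h1
    simpa [c, ρ] using h1.symm
  -- the relation `d • φ = Σ φ(x i) • c i` in `N*`
  have hφ : ∀ (φ : Module.Dual S N) (n : N), d * φ n = ∑ i, c i n * φ (x i) := by
    intro φ n
    have := congrArg φ (hc n)
    rw [map_smul, smul_eq_mul, map_sum] at this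
    rw [this]
    exact Finset.sum_congr rfl fun i _ => by rw [map_smul, smul_eq_mul]
  constructor
  · -- injective
    rw [injective_iff_map_eq_zero]
    intro w hw
    obtain ⟨s, hs, ⟨n, hn⟩, -⟩ := w.2
    have hφ0 : ∀ φ : Module.Dual S N, φ n = 0 := fun φ => by
      rw [reflexiveHullToDoubleDual_spec N w φ hn, hw, LinearMap.zero_apply, mul_zero]
    have hdn : d • n = 0 := by
      rw [hc n]
      exact Finset.sum_eq_zero fun i _ => by rw [hφ0 (c i), zero_smul]
    have hn0 : n = 0 := by
      rcases smul_eq_zero.mp hdn with h | h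
      · exact absurd h hd
      · exact h
    have : s • (w : W) = 0 := by rw [← hn, hn0]; simp
    rcases smul_eq_zero.mp this with h | h
    · exact absurd h hs
    · exact Subtype.ext h
  · -- surjective
    intro ψ
    let n₁ : N := ∑ i, ψ (c i) • x i
    let w : W := (algebraMap S K d)⁻¹ • (n₁ : W)
    have hdK : algebraMap S K d ≠ 0 := (map_ne_zero_iff _ hinjK).mpr hd
    have hdw : (n₁ : W) = d • w := by
      simp only [w, ← smul_assoc, Algebra.smul_def, mul_inv_cancel₀ hdK, one_smul]
    have hdiv : ∀ φ : Module.Dual S N, φ n₁ = d * ψ φ := by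
      intro φ
      have h1 : (d • φ : Module.Dual S N) = ∑ i, φ (x i) • c i := by
        ext n
        rw [LinearMap.smul_apply, smul_eq_mul, hφ φ n, LinearMap.coe_sum, Finset.sum_apply]
        exact Finset.sum_congr rfl fun i _ => by rw [LinearMap.smul_apply, smul_eq_mul, mul_comm]
      have h2 := congrArg ψ h1
      rw [map_smul, smul_eq_mul, map_sum] at h2
      simp only [n₁, map_sum, map_smul, smul_eq_mul]
      rw [h2]
      exact Finset.sum_congr rfl fun i _ => by rw [map_smul, smul_eq_mul, mul_comm]
    have hw : w ∈ reflexiveHull N :=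
      (mem_reflexiveHull_iff_forall_dvd N hd n₁ hdw).2 fun φ => ⟨ψ φ, hdiv φ⟩
    refine ⟨⟨w, hw⟩, ?_⟩
    ext φ
    have := reflexiveHullToDoubleDual_spec N ⟨w, hw⟩ φ (n := n₁) hdw
    rw [hdiv] at this
    exact (mul_left_cancel₀ hd this).symm

/-- The reflexive hull of a finitely generated `N` inside a `K`-vector space, as the double dual:
`hull N ≃ₗ[S] N**`. [cite: BrunsHerzog1998, Prop. 1.4.1] -/
def reflexiveHullEquiv [NoZeroSMulDivisors S W] [FaithfulSMul S K] (N : Submodule S W)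
    [Module.Finite S N] : reflexiveHull N ≃ₗ[S] Module.Dual S (Module.Dual S N) :=
  LinearEquiv.ofBijective _ (reflexiveHullToDoubleDual_bijective (K := K) N)

/-- Unfolding of `reflexiveHullEquiv`. [cite: BrunsHerzog1998, Prop. 1.4.1] -/
theorem reflexiveHullEquiv_apply [NoZeroSMulDivisors S W] [FaithfulSMul S K] (N : Submodule S W)
    [Module.Finite S N] (w : reflexiveHull N) : reflexiveHullEquiv (K := K) N w = reflexiveHullToDoubleDual N w := rfl

/-- Over a NOETHERIAN domain the hull of a finitely generated lattice in a vector space is finitely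
generated (it is the double dual). [cite: BrunsHerzog1998, Prop. 1.4.1] -/
theorem finite_reflexiveHull [NoZeroSMulDivisors S W] [FaithfulSMul S K] [IsNoetherianRing S]
    (N : Submodule S W) [Module.Finite S N] : Module.Finite S (reflexiveHull N) :=
  Module.Finite.equiv (reflexiveHullEquiv (K := K) N).symm

end Lattice

end Summit.ResolutionOfSingularities.ResolutionOfSingularities.Theorems.NoZeno.SandwichCluster

end
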